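import Summits.AtomisticToContinuum.HydrodynamicLimit.Theorems.CollisionIsometryCLTMacroClosureEngineDefs
import Summits.AtomisticToContinuum.HydrodynamicLimit.Theorems.CollisionIsometryCLTMacroClosureStubThermoLambda
import Summits.AtomisticToContinuum.HydrodynamicLimit.Theorems.CollisionIsometryCLTMacroClosureStubThermoFlux
import HarnessLib

/-!
# Sub-goal `engine_classical` of the lead's stub `stub_engine` (line `IdeatorTwoGen1Sketch`, crux
# `MacroClosure`, stmt-AtomisticToContinuum-14870): the classical half of the increment

For a classical hs-Euler solution `(ρ, u, θ)` on `[0, T)` staying in the dilute chamber of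
`ThermoChamber η₃`, with `U = Ucl ρ θ u` (the conserved state field) and `Λ = Lcl σ ρ θ u = Dη_σ(U)`
(the entropy variables), the classical pairing `s ↦ ∫ₓ Λ(s,x)·U(s,x) dx` satisfies, for `0 ≤ s < T`,
`[∫ₓ Λ·U]₀ˢ = ∫_{[0,s]} prodCl(τ) dτ`, `prodCl τ = ∫ₓ [∂_τΛ·U + Σⱼ ∂ⱼΛ·Fⱼ(U)]` (one-sided time
derivative within `[0, T)`).

Proof. (1) `Λ` is jointly smooth (clause 3 of `ThermoChamber`), `U` is jointly smooth (fields of the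
solution), so `(s, x) ↦ Λ(s,x)(U(s,x))` is jointly smooth and `d/ds ∫ₓ Λ·U = ∫ₓ ∂ₛ(Λ·U)` within
`[0, T)` (`IsSmoothSpaceTimeOn.hasDerivWithinAt_integral`). (2) Product rule:
`∂ₛ(Λ·U) = ∂ₛΛ·U + Λ·∂ₛU`. (3) The Euler equations in conservation form read
`∂ₛU = −Σⱼ ∂ⱼ[Fⱼ∘U]` (`timeDerivWithin_Ucl_eq`: componentwise `mass` / `momentum` / `energy`, with
`Fⱼ(U) = (ρuⱼ, ρuⱼ u + p eⱼ, (E + p)uⱼ)` and `∇p = Σⱼ ∂ⱼp eⱼ`; the pressure slice is smooth because the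
fluxes are smooth on the chamber, clause 1). (4) Integration by parts on the torus with the product
rule for `x ↦ Λ(x)(G(x))` gives `∫ₓ Λ·∂ₛU = ∫ₓ Σⱼ ∂ⱼΛ·Fⱼ(U)` (`integral_Lambda_dtU`), hence
`d/ds ∫ₓ Λ·U = prodCl`. (5) The fundamental theorem of calculus on `[0, s] ⊂ [0, T)`
(`intervalIntegral.integral_eq_sub_of_hasDeriv_right_of_le`; `prodCl` is continuous as the space
integral of a jointly smooth field).
-/

noncomputable section

open MeasureTheory Filter Set Topology InformationTheory
open scoped ENNReal ContDiff

namespace Summit.AtomisticToContinuum.HydrodynamicLimit.Theorems.MacroClosureLine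

open Literature.MathematicalPhysics.KineticTheory Literature.Analysis.FluidPDE
open Literature.Analysis.FunctionSpaces

namespace Barycentric

namespace EngineClassical

/-! ## Torus calculus: product rules for operator-valued fields, integration by parts -/

section Calculus

variable {E' G' : Type*} [NormedAddCommGroup E'] [NormedSpace ℝ E']
  [NormedAddCommGroup G'] [NormedSpace ℝ G']

/-- A `C¹` function on `𝕋³` restricted to the `i`-th coordinate line through `x` has derivative
`∂ᵢf(x)` at parameter `0` (vector-valued version of `HsEulerCalc.hasDerivAt_coordLine`). -/
theorem hasDerivAt_coordLine {f : T3 → E'} (hf : Torus.IsContDiff 1 f) (x : T3) (i : Fin 3) :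
    HasDerivAt (fun s : ℝ => f (x + Torus.proj (s • EuclideanSpace.single i (1 : ℝ))))
      (Torus.partialDeriv i f x) 0 := by
  have h := Torus.hasDerivAt_comp_add_proj_smul hf x (EuclideanSpace.single i (1 : ℝ)) 0
  simp only [zero_smul, Torus.proj_zero, add_zero] at h
  exact h

/-- The partial derivative `∂ᵢf(x)` is read off from a derivative along the coordinate line. -/
theorem partialDeriv_eq_of_hasDerivAt {f : T3 → E'} {x : T3} {i : Fin 3} {f' : E'}
    (h : HasDerivAt (fun s : ℝ => f (x + Torus.proj (s • EuclideanSpace.single i (1 : ℝ)))) f' 0) :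
    Torus.partialDeriv i f x = f' :=
  h.deriv

/-- Applying a `Cⁿ` operator field to a `Cⁿ` vector field on the torus gives a `Cⁿ` function. -/
theorem isContDiff_clm_apply {n : WithTop ℕ∞} {L : T3 → (E' →L[ℝ] G')} {G : T3 → E'}
    (hL : Torus.IsContDiff n L) (hG : Torus.IsContDiff n G) :
    Torus.IsContDiff n (fun y => L y (G y)) :=
  ContDiff.clm_apply hL hG

/-- Applying a smooth operator field to a smooth vector field on the torus gives a smooth function. -/
theorem isSmooth_clm_apply {L : T3 → (E' →L[ℝ] G')} {G : T3 → E'} (hL : Torus.IsSmooth L)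
    (hG : Torus.IsSmooth G) : Torus.IsSmooth (fun y => L y (G y)) :=
  ContDiff.clm_apply hL hG

/-- Leibniz rule for partial derivatives of `x ↦ L(x)(G(x))` (operator field applied to a vector
field), `C¹` data. -/
theorem partialDeriv_clm_apply₂ {L : T3 → (E' →L[ℝ] G')} {G : T3 → E'} (hL : Torus.IsContDiff 1 L)
    (hG : Torus.IsContDiff 1 G) (j : Fin 3) (x : T3) :
    Torus.partialDeriv j (fun y => L y (G y)) x =
      Torus.partialDeriv j L x (G x) + L x (Torus.partialDeriv j G x) := by
  have h := (hasDerivAt_coordLine hL x j).clm_apply (hasDerivAt_coordLine hG x j)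
  simp only [zero_smul, Torus.proj_zero, add_zero] at h
  exact partialDeriv_eq_of_hasDerivAt h

/-- Leibniz rule for the one-sided time derivative of `(s, x) ↦ L(s,x)(G(s,x))` for jointly smooth
fields, on a time set of unique differentiability. -/
theorem timeDerivWithin_clm_apply₂ {S : Set ℝ} {L : ℝ → T3 → (E' →L[ℝ] G')} {G : ℝ → T3 → E'}
    (hL : Torus.IsSmoothSpaceTimeOn S L) (hG : Torus.IsSmoothSpaceTimeOn S G) (hS : UniqueDiffOn ℝ S)
    {t : ℝ} (ht : t ∈ S) (x : T3) :
    Torus.timeDerivWithin S (fun s y => L s y (G s y)) t x =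
      Torus.timeDerivWithin S L t x (G t x) + L t x (Torus.timeDerivWithin S G t x) :=
  ((hL.hasDerivWithinAt_slice ht x).clm_apply (hG.hasDerivWithinAt_slice ht x)).derivWithin (hS t ht)

/-- **Integration by parts against an operator field.** For smooth `L : 𝕋³ → (E' →L ℝ)` and smooth
`G j : 𝕋³ → E'`, `∫ Σⱼ ∂ⱼL·Gⱼ = −∫ L·(Σⱼ ∂ⱼGⱼ)` (`∫ ∂ⱼ(L·Gⱼ) = 0` on the torus). -/
theorem integral_sum_partialDeriv_clm_apply {L : T3 → (E' →L[ℝ] ℝ)} {G : Fin 3 → T3 → E'}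
    (hL : Torus.IsSmooth L) (hG : ∀ j, Torus.IsSmooth (G j)) :
    ∫ x, ∑ j, Torus.partialDeriv j L x (G j x) = -∫ x, L x (∑ j, Torus.partialDeriv j (G j) x) := by
  have hL1 : Torus.IsContDiff 1 L := hL.isContDiff (by simp)
  have hG1 : ∀ j, Torus.IsContDiff 1 (G j) := fun j => (hG j).isContDiff (by simp)
  have hj : ∀ j, ∫ x, Torus.partialDeriv j L x (G j x) = -∫ x, L x (Torus.partialDeriv j (G j) x) := by
    intro j
    have h0 : ∫ x, Torus.partialDeriv j (fun y => L y (G j y)) x = 0 :=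
      Torus.integral_partialDeriv_eq_zero_of_isContDiff (isContDiff_clm_apply hL1 (hG1 j)) j
    simp_rw [partialDeriv_clm_apply₂ hL1 (hG1 j)] at h0
    rw [integral_add (isSmooth_clm_apply (hL.partialDeriv j) (hG j)).integrable
      (isSmooth_clm_apply hL ((hG j).partialDeriv j)).integrable] at h0
    linarith
  rw [integral_finsetSum _ fun j _ => (isSmooth_clm_apply (hL.partialDeriv j) (hG j)).integrable]
  simp_rw [hj, map_sum]
  rw [integral_finsetSum _ fun j _ => (isSmooth_clm_apply hL ((hG j).partialDeriv j)).integrable,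
    Finset.sum_neg_distrib]

end Calculus

/-! ## The classical solution: smoothness, the pressure, the conservation form -/

section Solution

variable {σ η₃ T : ℝ} {ρ θ : ℝ → T3 → ℝ} {u : ℝ → T3 → V3}

/-- The classical state field stays in the chamber `chamber σ η₃`. -/
theorem Ucl_mem (hE : IsHardSphereEulerSolution σ T ρ u θ)
    (hpack : ∀ s ∈ Ico 0 T, ∀ x, ρ s x * σ ^ 3 < η₃) {s : ℝ} (hs : s ∈ Ico 0 T) (x : T3) :
    Ucl ρ θ u s x ∈ chamber σ η₃ :=
  stateOf_mem_chamber (u s x) (hE.density_pos s hs x) (hE.temperature_pos s hs x) (hpack s hs x)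

/-- The classical state field `U_cl` is jointly smooth on `[0, T) × 𝕋³`. -/
theorem isSmoothSpaceTimeOn_Ucl (hE : IsHardSphereEulerSolution σ T ρ u θ) :
    Torus.IsSmoothSpaceTimeOn (Ico 0 T) (Ucl ρ θ u) :=
  isSmoothSpaceTimeOn_stateOf hE

/-- A function smooth on the chamber, composed with the classical state field, is jointly smooth. -/
theorem isSmoothSpaceTimeOn_comp_Ucl {G' : Type*} [NormedAddCommGroup G'] [NormedSpace ℝ G']
    {g : State → G'} (hg : ContDiffOn ℝ ∞ g (chamber σ η₃)) (hE : IsHardSphereEulerSolution σ T ρ u θ)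
    (hpack : ∀ s ∈ Ico 0 T, ∀ x, ρ s x * σ ^ 3 < η₃) :
    Torus.IsSmoothSpaceTimeOn (Ico 0 T) (fun s x => g (Ucl ρ θ u s x)) := by
  refine hg.comp (isSmoothSpaceTimeOn_Ucl hE) ?_
  rintro ⟨s, y⟩ hp
  exact Ucl_mem hE hpack (mem_prod.1 hp).1 _

/-- The pressure as a function of the conserved state is a rational combination of a flux
component and the state: `p(U) = (F₀(U)).m₀ − m₀²/ρ`. -/
theorem pressure_eq_flux (σ : ℝ) (U : State) :
    hsPressure σ U.1 (stateTemp U) = (eulerFlux σ 0 U).2.1 0 - U.2.1 0 / U.1 * U.2.1 0 := by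
  simp only [eulerFlux, PiLp.add_apply, PiLp.smul_apply, smul_eq_mul, PiLp.single_apply, if_true,
    mul_one]
  ring

/-- **The pressure field `p = hsPressure σ ρ θ` of the solution is jointly smooth on `[0, T) × 𝕋³`**
when the flux `F₀` is smooth on a chamber containing the solution. -/
theorem isSmoothSpaceTimeOn_pressure (hE : IsHardSphereEulerSolution σ T ρ u θ)
    (hF0 : ContDiffOn ℝ ∞ (eulerFlux σ 0) (chamber σ η₃))
    (hpack : ∀ s ∈ Ico 0 T, ∀ x, ρ s x * σ ^ 3 < η₃) :
    Torus.IsSmoothSpaceTimeOn (Ico 0 T) (fun s y => hsPressure σ (ρ s y) (θ s y)) := by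
  have h1 : ContDiff ℝ ∞ fun U : State => U.1 := contDiff_fst
  have h2 : ContDiff ℝ ∞ fun U : State => U.2.1 0 :=
    (EuclideanSpace.proj (0 : Fin 3) : V3 →L[ℝ] ℝ).contDiff.comp (contDiff_fst.comp contDiff_snd)
  have h3 : ContDiffOn ℝ ∞ (fun U : State => (eulerFlux σ 0 U).2.1 0) (chamber σ η₃) :=
    ((EuclideanSpace.proj (0 : Fin 3) : V3 →L[ℝ] ℝ).contDiff.comp
      (contDiff_fst.comp contDiff_snd)).comp_contDiffOn hF0
  have hq : ContDiffOn ℝ ∞ (fun U : State => (eulerFlux σ 0 U).2.1 0 - U.2.1 0 / U.1 * U.2.1 0)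
      (chamber σ η₃) :=
    h3.sub ((h2.contDiffOn.div h1.contDiffOn fun U hU => hU.1.ne').mul h2.contDiffOn)
  have hP : ContDiffOn ℝ ∞ (fun U : State => hsPressure σ U.1 (stateTemp U)) (chamber σ η₃) :=
    hq.congr fun U _ => pressure_eq_flux σ U
  refine (isSmoothSpaceTimeOn_comp_Ucl hP hE hpack).congr ?_
  rintro ⟨s, y⟩ hp
  have hs : s ∈ Ico 0 T := (mem_prod.1 hp).1
  simp only [Torus.stLift_apply]
  rw [Ucl, stateOf_fst, stateTemp_stateOf (hE.density_pos s hs _).ne']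

/-- **The Euler equations in conservation form**, as an identity of `State`-valued fields:
`∂ₛU_cl(s, x) = −Σⱼ ∂ⱼ[x ↦ Fⱼ(U_cl(s, x))]` on `[0, T) × 𝕋³` (one-sided time derivative), given
that the pressure slice `x ↦ p(s, x)` is `C¹`. Componentwise these are the `mass`, `momentum`
(with `∇p = Σⱼ ∂ⱼp eⱼ`) and `energy` equations of `IsHardSphereEulerSolution`. -/
theorem timeDerivWithin_Ucl_eq (hE : IsHardSphereEulerSolution σ T ρ u θ) {s : ℝ} (hs : s ∈ Ico 0 T)
    (hp1 : Torus.IsContDiff 1 (fun y => hsPressure σ (ρ s y) (θ s y))) (x : T3) :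
    Torus.timeDerivWithin (Ico 0 T) (Ucl ρ θ u) s x =
      -∑ j, Torus.partialDeriv j (fun y => eulerFlux σ j (Ucl ρ θ u s y)) x := by
  have hS : UniqueDiffOn ℝ (Ico (0 : ℝ) T) := uniqueDiffOn_Ico 0 T
  -- the three balance laws at `(s, x)`
  have hmass := hE.mass s hs x
  have hmom := hE.momentum s hs x
  have hen := hE.energy s hs x
  simp only [Torus.divergence, PiLp.smul_apply, smul_eq_mul] at hmass hen
  -- jointly smooth building blocks
  have hρ := hE.smooth_density
  have hu := hE.smooth_velocity
  have hm : Torus.IsSmoothSpaceTimeOn (Ico 0 T) (fun s y => ρ s y • u s y) := hρ.smul hu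
  have hEn : Torus.IsSmoothSpaceTimeOn (Ico 0 T)
      (fun s y => totalEnergyDensity (ρ s y) (u s y) (θ s y)) :=
    ((isSmoothSpaceTimeOn_Ucl hE).clm_comp (ContinuousLinearMap.snd ℝ ℝ (V3 × ℝ))).clm_comp
      (ContinuousLinearMap.snd ℝ V3 ℝ)
  have hρ1 : Torus.IsContDiff 1 (ρ s) := (hρ.isSmooth_slice hs).isContDiff (by simp)
  have hu1 : Torus.IsContDiff 1 (u s) := (hu.isSmooth_slice hs).isContDiff (by simp)
  have hEn1 : Torus.IsContDiff 1 (fun y => totalEnergyDensity (ρ s y) (u s y) (θ s y)) :=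
    (hEn.isSmooth_slice hs).isContDiff (by simp)
  have huj1 : ∀ j, Torus.IsContDiff 1 (fun y => u s y j) := fun j =>
    HsEulerCalc.isContDiff_apply_coord hu1 j
  have hA1 : ∀ j, Torus.IsContDiff 1 (fun y => ρ s y * u s y j) := fun j =>
    ContDiff.mul hρ1 (huj1 j)
  have hB1 : ∀ j, Torus.IsContDiff 1 (fun y => (ρ s y * u s y j) • u s y) := fun j =>
    ContDiff.smul (hA1 j) hu1
  have hC1 : ∀ j, Torus.IsContDiff 1 (fun y =>
      (totalEnergyDensity (ρ s y) (u s y) (θ s y) + hsPressure σ (ρ s y) (θ s y)) * u s y j) :=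
    fun j => ContDiff.mul (ContDiff.add hEn1 hp1) (huj1 j)
  -- the flux slices in primitive variables
  have hfl : ∀ j, (fun y => eulerFlux σ j (Ucl ρ θ u s y)) = fun y =>
      (ρ s y * u s y j, (ρ s y * u s y j) • u s y +
        hsPressure σ (ρ s y) (θ s y) • EuclideanSpace.single j (1 : ℝ),
        (totalEnergyDensity (ρ s y) (u s y) (θ s y) + hsPressure σ (ρ s y) (θ s y)) * u s y j) := by
    intro j
    funext y
    rw [Ucl, eulerFlux_stateOf σ (hE.density_pos s hs y).ne' (u s y) (θ s y) j]
    rfl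
  -- the time derivative of `U_cl`, componentwise
  have hUt : Torus.timeDerivWithin (Ico 0 T) (Ucl ρ θ u) s x =
      (Torus.timeDerivWithin (Ico 0 T) ρ s x,
        Torus.timeDerivWithin (Ico 0 T) (fun s y => ρ s y • u s y) s x,
        Torus.timeDerivWithin (Ico 0 T) (fun s y => totalEnergyDensity (ρ s y) (u s y) (θ s y)) s x) :=
    ((hρ.hasDerivWithinAt_slice hs x).prodMk ((hm.hasDerivWithinAt_slice hs x).prodMk
      (hEn.hasDerivWithinAt_slice hs x))).derivWithin (hS s hs)
  -- the partial derivatives of the flux slices, componentwise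
  have hFx : ∀ j, Torus.partialDeriv j (fun y => eulerFlux σ j (Ucl ρ θ u s y)) x =
      (Torus.partialDeriv j (fun y => ρ s y * u s y j) x,
        Torus.partialDeriv j (fun y => (ρ s y * u s y j) • u s y) x +
          Torus.partialDeriv j (fun y => hsPressure σ (ρ s y) (θ s y)) x •
            EuclideanSpace.single j (1 : ℝ),
        Torus.partialDeriv j (fun y =>
          (totalEnergyDensity (ρ s y) (u s y) (θ s y) + hsPressure σ (ρ s y) (θ s y)) * u s y j) x) := by
    intro j
    rw [hfl j]
    exact partialDeriv_eq_of_hasDerivAt ((hasDerivAt_coordLine (hA1 j) x j).prodMk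
      (((hasDerivAt_coordLine (hB1 j) x j).add ((hasDerivAt_coordLine hp1 x j).smul_const _)).prodMk
        (hasDerivAt_coordLine (hC1 j) x j)))
  rw [hUt]
  simp only [hFx, ← prod_mk_sum, Finset.sum_add_distrib, Prod.neg_mk]
  rw [← Torus.gradient_eq_sum_partialDeriv hp1 x]
  refine Prod.ext ?_ (Prod.ext ?_ ?_)
  · linarith
  · exact eq_neg_of_add_eq_zero_left (by rw [← add_assoc]; exact hmom)
  · linarith

/-- **`∫ₓ Λ·∂ₛU_cl = ∫ₓ Σⱼ ∂ⱼΛ·Fⱼ(U_cl)`**: the conservation form `∂ₛU_cl = −Σⱼ ∂ⱼ(Fⱼ∘U_cl)` and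
integration by parts against the smooth operator field `Λ = Lcl σ ρ θ u s`. -/
theorem integral_Lambda_dtU {s : ℝ} (hΛs : Torus.IsSmooth (Lcl σ ρ θ u s))
    (hFs : ∀ j, Torus.IsSmooth (fun y => eulerFlux σ j (Ucl ρ θ u s y)))
    (hcons : ∀ x, Torus.timeDerivWithin (Ico 0 T) (Ucl ρ θ u) s x =
      -∑ j, Torus.partialDeriv j (fun y => eulerFlux σ j (Ucl ρ θ u s y)) x) :
    ∫ x, Lcl σ ρ θ u s x (Torus.timeDerivWithin (Ico 0 T) (Ucl ρ θ u) s x) =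
      ∫ x, ∑ j, Torus.partialDeriv j (Lcl σ ρ θ u s) x (eulerFlux σ j (Ucl ρ θ u s x)) := by
  rw [integral_sum_partialDeriv_clm_apply (G := fun j y => eulerFlux σ j (Ucl ρ θ u s y)) hΛs hFs]
  simp_rw [hcons, map_neg, integral_neg]

end Solution

end EngineClassical

/-! ## The sub-goal -/

/-- **`engine_classical` (registered sub-goal of `stub_engine`): the classical half of the increment.**
For a classical hs-Euler solution in the dilute chamber of `ThermoChamber η₃` and `0 ≤ s < T`,
`∫ₓ Λ_cl(s)·U_cl(s) − ∫ₓ Λ_cl(0)·U_cl(0) = ∫_{[0,s]} prodCl(τ) dτ`: differentiation under the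
integral, the product rule, the conservation form of the Euler equations with integration by parts
(`∫ₓ Λ·∂ₛU = ∫ₓ Σⱼ ∂ⱼΛ·Fⱼ(U)`), and the fundamental theorem of calculus. -/
theorem engine_classical : ∀ (σ : ℝ), 0 < σ → ∀ (T : ℝ) (ρ θ : ℝ → T3 → ℝ) (u : ℝ → T3 → V3),
    IsHardSphereEulerSolution σ T ρ u θ → ∀ η₃ : ℝ, ThermoChamber η₃ →
    (∀ s ∈ Ico 0 T, ∀ x, ρ s x * σ ^ 3 < η₃) → ∀ s : ℝ, 0 ≤ s → s < T →
    (∫ x, Lcl σ ρ θ u s x (Ucl ρ θ u s x)) - (∫ x, Lcl σ ρ θ u 0 x (Ucl ρ θ u 0 x)) =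
      ∫ τ in Icc 0 s, prodCl σ T ρ θ u τ := by
  intro σ hσ T ρ θ u hE η₃ hT hpack s hs0 hsT
  -- clauses 1 and 3 of `ThermoChamber`
  have hF : ∀ j, ContDiffOn ℝ ∞ (eulerFlux σ j) (chamber σ η₃) := (hT σ hσ).1.2
  obtain ⟨hΛ0, -, -, hflux0⟩ := (hT σ hσ).2.2 T ρ θ u hE hpack
  have hΛ : Torus.IsSmoothSpaceTimeOn (Ico 0 T) (Lcl σ ρ θ u) := hΛ0
  have hflux : ∀ τ ∈ Ico 0 T,
      ∫ x, ∑ j, Torus.partialDeriv j (Lcl σ ρ θ u τ) x (eulerFlux σ j (Ucl ρ θ u τ x)) = 0 := hflux0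
  have hS : UniqueDiffOn ℝ (Ico (0 : ℝ) T) := uniqueDiffOn_Ico 0 T
  have hU : Torus.IsSmoothSpaceTimeOn (Ico 0 T) (Ucl ρ θ u) := EngineClassical.isSmoothSpaceTimeOn_Ucl hE
  have hFU : ∀ j, Torus.IsSmoothSpaceTimeOn (Ico 0 T) (fun s x => eulerFlux σ j (Ucl ρ θ u s x)) :=
    fun j => EngineClassical.isSmoothSpaceTimeOn_comp_Ucl (hF j) hE hpack
  have hP := EngineClassical.isSmoothSpaceTimeOn_pressure hE (hF 0) hpack
  -- the jointly smooth integrands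
  have hg : Torus.IsSmoothSpaceTimeOn (Ico 0 T) (fun τ x => Lcl σ ρ θ u τ x (Ucl ρ θ u τ x)) :=
    ContDiffOn.clm_apply hΛ hU
  have hA : Torus.IsSmoothSpaceTimeOn (Ico 0 T)
      (fun τ x => Torus.timeDerivWithin (Ico 0 T) (Lcl σ ρ θ u) τ x (Ucl ρ θ u τ x)) :=
    ContDiffOn.clm_apply (hΛ.timeDerivWithin hS) hU
  have hB : Torus.IsSmoothSpaceTimeOn (Ico 0 T)
      (fun τ x => Lcl σ ρ θ u τ x (Torus.timeDerivWithin (Ico 0 T) (Ucl ρ θ u) τ x)) :=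
    ContDiffOn.clm_apply hΛ (hU.timeDerivWithin hS)
  have hC : Torus.IsSmoothSpaceTimeOn (Ico 0 T)
      (fun τ x => ∑ j, Torus.partialDeriv j (Lcl σ ρ θ u τ) x (eulerFlux σ j (Ucl ρ θ u τ x))) :=
    Torus.IsSmoothSpaceTimeOn.sum fun j _ => ContDiffOn.clm_apply (hΛ.partialDeriv hS j) (hFU j)
  have hPr : Torus.IsSmoothSpaceTimeOn (Ico 0 T)
      (fun τ x => Torus.timeDerivWithin (Ico 0 T) (Lcl σ ρ θ u) τ x (Ucl ρ θ u τ x) +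
        ∑ j, Torus.partialDeriv j (Lcl σ ρ θ u τ) x (eulerFlux σ j (Ucl ρ θ u τ x))) :=
    hA.add hC
  -- the derivative of `τ ↦ ∫ₓ Λ·U` within `[0, T)` is `prodCl τ`
  have hderiv : ∀ τ ∈ Ico 0 T, HasDerivWithinAt (fun τ => ∫ x, Lcl σ ρ θ u τ x (Ucl ρ θ u τ x))
      (prodCl σ T ρ θ u τ) (Ico 0 T) τ := by
    intro τ hτ
    have h1 := hg.hasDerivWithinAt_integral (convex_Ico 0 T) hτ
    have hpt : (fun x => Torus.timeDerivWithin (Ico 0 T) (fun τ x => Lcl σ ρ θ u τ x (Ucl ρ θ u τ x)) τ x) =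
        fun x => Torus.timeDerivWithin (Ico 0 T) (Lcl σ ρ θ u) τ x (Ucl ρ θ u τ x) +
          Lcl σ ρ θ u τ x (Torus.timeDerivWithin (Ico 0 T) (Ucl ρ θ u) τ x) :=
      funext fun x => EngineClassical.timeDerivWithin_clm_apply₂ hΛ hU hS hτ x
    have hcons : ∀ x, Torus.timeDerivWithin (Ico 0 T) (Ucl ρ θ u) τ x =
        -∑ j, Torus.partialDeriv j (fun y => eulerFlux σ j (Ucl ρ θ u τ y)) x := fun x =>
      EngineClassical.timeDerivWithin_Ucl_eq hE hτ ((hP.isSmooth_slice hτ).isContDiff (by simp)) x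
    rw [hpt, integral_add (hA.isSmooth_slice hτ).integrable (hB.isSmooth_slice hτ).integrable,
      EngineClassical.integral_Lambda_dtU (hΛ.isSmooth_slice hτ) (fun j => (hFU j).isSmooth_slice hτ)
        hcons,
      ← integral_add (hA.isSmooth_slice hτ).integrable (hC.isSmooth_slice hτ).integrable] at h1
    exact h1
  -- the fundamental theorem of calculus on `[0, s]`
  have hcont : ContinuousOn (fun τ => ∫ x, Lcl σ ρ θ u τ x (Ucl ρ θ u τ x)) (Icc 0 s) :=
    (hg.continuousOn_integral (convex_Ico 0 T)).mono (Icc_subset_Ico_right hsT)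
  have hint : IntervalIntegrable (prodCl σ T ρ θ u) volume 0 s := by
    refine ContinuousOn.intervalIntegrable_of_Icc hs0 ?_
    exact (hPr.continuousOn_integral (convex_Ico 0 T)).mono (Icc_subset_Ico_right hsT)
  have hFTC := intervalIntegral.integral_eq_sub_of_hasDeriv_right_of_le hs0 hcont
    (fun τ hτ => ((hderiv τ ⟨hτ.1.le, hτ.2.trans hsT⟩).hasDerivAt
      (mem_of_superset (Ioo_mem_nhds hτ.1 (hτ.2.trans hsT)) Ioo_subset_Ico_self)).hasDerivWithinAt)
    hint
  rw [integral_Icc_eq_integral_Ioc, ← intervalIntegral.integral_of_le hs0, hFTC]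

end Barycentric

end Summit.AtomisticToContinuum.HydrodynamicLimit.Theorems.MacroClosureLine

end
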